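import Literature.NumberTheory.DiophantineGeometry.AbcExceptionalSetBounds
import HarnessLib

/-!
# Factorisation of an integer into "shapes" `c · ∏ⱼ xⱼʲ` (Bernert–Browning–Lichtman–Teräväinen, Lemma 2.2)

This file proves **Lemma 2.2** of C. Bernert, T. Browning, J. D. Lichtman, J. Teräväinen,
*Bounds on the exceptional set in the abc conjecture* (arXiv:2410.12234; Lemma 2.2 in v1 and v2),
the first step ("reduction to Diophantine equations", §2 of the source) of the proofs of their
Theorems 1.2 and 1.3 on `N_λ(X)` (`abcExponentCount`, named facts `bernertEtAl2024_thm_1_2`,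
`bernertEtAl2024_thm_1_3` of `Literature.NumberTheory.DiophantineGeometry.AbcExceptionalSetBounds`,
which are NOT proved here):

> **Lemma 2.2.** Let `ε ∈ (0, 1/2)`, and let `2 ≤ n ≤ X` be an integer. Then there exists a
> factorisation `n = c ∏_{j ≤ 10 ε⁻²} x_j^j`, for positive integers `x_j, c` such that
> `c ≤ X^{ε/2}`, the `x_j` are pairwise coprime, and
> `X^{-ε} ∏_{j ≤ 10ε⁻²} x_j ≤ rad(n) ≤ X^{ε} ∏_{j ≤ 10ε⁻²} x_j`.

(`bernertEtAl2024_lemma_2_2`; we allow `n = 1` as well, where everything is `1`.) The proof is the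
printed one. With `K = 2⌈ε⁻¹⌉`, `M = ⌊10 ε⁻²⌋` and `y_j = ∏_{p^j ∥ n} p`
(`AbcShapes.exactRadical n j`, squarefree and pairwise coprime, `∏ⱼ y_j^j = n`, `∏ⱼ y_j = rad n`),
put `x_j = y_j` for `j ≤ M`, `j ≠ K`, `x_K = y_K ∏_{m > M} y_m^{⌊m/K⌋}` and
`c = ∏_{m > M} y_m^{m - K⌊m/K⌋}`. Then `c ∏_{j ≤ M} x_j^j = ∏_m y_m^m = n`;
`(∏_{m > M} y_m)^M ≤ ∏_{m > M} y_m^m ≤ n ≤ X` gives `∏_{m > M} y_m ≤ X^{1/M}` and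
`c ≤ (∏_{m > M} y_m)^K ≤ X^{K/M} ≤ X^{ε/2}`; `x_K^K ≤ n ≤ X` gives `x_K ≤ X^{1/K} ≤ X^{ε/2}`;
finally `rad n = ∏_{j ≤ M} y_j · ∏_{m > M} y_m ≤ X^{ε/2} ∏_{j ≤ M} x_j` and
`∏_{j ≤ M} x_j ≤ x_K ∏_{j ≤ M, j ≠ K} y_j ≤ X^{ε/2} rad n`. The numerology
`K/M ≤ ε/2`, `1/K ≤ ε/2`, `K ≤ M` uses `ε < 1/2`.

## References

* [BernertEtAl2024] C. Bernert, T. Browning, J. D. Lichtman, J. Teräväinen, *Bounds on the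
  exceptional set in the abc conjecture*, arXiv:2410.12234 (v1 2024, v2 2026), Lemma 2.2.
-/

noncomputable section

open UniqueFactorizationMonoid Finset

namespace Literature.NumberTheory.DiophantineGeometry

namespace AbcShapes

/-! ### The exact-multiplicity radicals `y_j(n) = ∏_{p^j ∥ n} p` -/

/-- `y_j(n) = ∏_{p^j ∥ n} p`: the product of the primes dividing `n` with exact multiplicity `j`
(notation of the proof of [BernertEtAl2024, Lemma 2.2]). [cite: BernertEtAl2024, Lemma 2.2] -/
def exactRadical (n j : ℕ) : ℕ :=
  ∏ p ∈ n.primeFactors with n.factorization p = j, p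

/-- Unfolding lemma for `exactRadical`. [folklore] -/
theorem exactRadical_def (n j : ℕ) :
    exactRadical n j = ∏ p ∈ n.primeFactors with n.factorization p = j, p :=
  rfl

/-- `y_j(n) ≥ 1` (a product of primes). [folklore] -/
theorem exactRadical_pos (n j : ℕ) : 0 < exactRadical n j :=
  prod_pos fun _ hp => (Nat.prime_of_mem_primeFactors (mem_filter.mp hp).1).pos

/-- The `y_j(n)` are pairwise coprime (they are products over disjoint sets of primes).
[folklore] -/
theorem coprime_exactRadical (n : ℕ) {i j : ℕ} (hij : i ≠ j) :
    Nat.Coprime (exactRadical n i) (exactRadical n j) := by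
  refine Nat.Coprime.prod_left fun p hp => Nat.Coprime.prod_right fun q hq => ?_
  obtain ⟨hp, hpi⟩ := mem_filter.mp hp
  obtain ⟨hq, hqj⟩ := mem_filter.mp hq
  refine (Nat.coprime_primes (Nat.prime_of_mem_primeFactors hp)
    (Nat.prime_of_mem_primeFactors hq)).mpr ?_
  rintro rfl
  exact hij (hpi.symm.trans hqj)

/-- The multiplicities of `n ≠ 0` lie in `(0, N]` as soon as `n ≤ N`. [folklore] -/
theorem factorization_mem_Ioc {n N : ℕ} (hn : n ≠ 0) (hN : n ≤ N) {p : ℕ}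
    (hp : p ∈ n.primeFactors) : n.factorization p ∈ Ioc 0 N :=
  mem_Ioc.mpr ⟨(Nat.prime_of_mem_primeFactors hp).factorization_pos_of_dvd hn
    (Nat.dvd_of_mem_primeFactors hp), (Nat.factorization_lt p hn).le.trans hN⟩

/-- `∏_{j ≤ N} y_j(n)^j = n` (grouping the prime factorisation by multiplicity). [folklore] -/
theorem prod_exactRadical_pow {n N : ℕ} (hn : n ≠ 0) (hN : n ≤ N) :
    ∏ j ∈ Ioc 0 N, exactRadical n j ^ j = n := by
  calc ∏ j ∈ Ioc 0 N, exactRadical n j ^ j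
      = ∏ j ∈ Ioc 0 N, ∏ p ∈ n.primeFactors with n.factorization p = j,
          p ^ n.factorization p := by
        refine prod_congr rfl fun j _ => ?_
        rw [exactRadical_def, ← prod_pow]
        exact prod_congr rfl fun p hp => by rw [(mem_filter.mp hp).2]
    _ = ∏ p ∈ n.primeFactors, p ^ n.factorization p :=
        prod_fiberwise_of_maps_to (fun p hp => factorization_mem_Ioc hn hN hp) _
    _ = n := by
        conv_rhs => rw [← Nat.prod_factorization_pow_eq_self hn]
        rw [Finsupp.prod, Nat.support_factorization]

/-- `∏_{j ≤ N} y_j(n) = rad n`. [folklore] -/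
theorem prod_exactRadical {n N : ℕ} (hn : n ≠ 0) (hN : n ≤ N) :
    ∏ j ∈ Ioc 0 N, exactRadical n j = radical n := by
  calc ∏ j ∈ Ioc 0 N, exactRadical n j
      = ∏ p ∈ n.primeFactors, p :=
        prod_fiberwise_of_maps_to (fun p hp => factorization_mem_Ioc hn hN hp) _
    _ = radical n := Nat.radical_eq_prod_primeFactors.symm

/-- Integer roots through real powers: `u ^ k ≤ X` gives `u ≤ X ^ (1/k)`. [folklore] -/
theorem cast_le_rpow_inv_of_pow_le {u k X : ℕ} (hk : 0 < k) (h : u ^ k ≤ X) :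
    (u : ℝ) ≤ (X : ℝ) ^ ((k : ℝ)⁻¹) := by
  have h' : (u : ℝ) ^ k ≤ (X : ℝ) := by exact_mod_cast h
  calc (u : ℝ) = ((u : ℝ) ^ k) ^ ((k : ℝ)⁻¹) :=
        (Real.pow_rpow_inv_natCast (Nat.cast_nonneg _) hk.ne').symm
    _ ≤ (X : ℝ) ^ ((k : ℝ)⁻¹) := Real.rpow_le_rpow (by positivity) h' (by positivity)

end AbcShapes

/-! ### Lemma 2.2 -/

open AbcShapes in
/-- **Bernert–Browning–Lichtman–Teräväinen, Lemma 2.2** (factorisation into shapes). Let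
`ε ∈ (0, 1/2)` and `1 ≤ n ≤ X` (the source has `2 ≤ n`; `n = 1` is trivially included). Then
`n = c ∏_{1 ≤ j ≤ ⌊10/ε²⌋} x_j^j` with positive integers `c ≤ X^{ε/2}` and `x_j`, the `x_j`
(`1 ≤ j ≤ ⌊10/ε²⌋`) pairwise coprime, and
`X^{-ε} ∏_{j} x_j ≤ rad n ≤ X^{ε} ∏_{j} x_j`. [cite: BernertEtAl2024, Lemma 2.2] -/
theorem bernertEtAl2024_lemma_2_2 {ε : ℝ} (hε : 0 < ε) (hε2 : ε < 1 / 2) {n X : ℕ} (hn : 0 < n)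
    (hnX : n ≤ X) :
    ∃ c : ℕ, ∃ x : ℕ → ℕ, 0 < c ∧ (∀ j, 0 < x j) ∧
      c * ∏ j ∈ Icc 1 ⌊10 / ε ^ 2⌋₊, x j ^ j = n ∧
      (c : ℝ) ≤ (X : ℝ) ^ (ε / 2) ∧
      (∀ i ∈ Icc 1 ⌊10 / ε ^ 2⌋₊, ∀ j ∈ Icc 1 ⌊10 / ε ^ 2⌋₊, i ≠ j →
        Nat.Coprime (x i) (x j)) ∧
      (X : ℝ) ^ (-ε) * ∏ j ∈ Icc 1 ⌊10 / ε ^ 2⌋₊, (x j : ℝ) ≤ (radical n : ℕ) ∧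
      ((radical n : ℕ) : ℝ) ≤ (X : ℝ) ^ ε * ∏ j ∈ Icc 1 ⌊10 / ε ^ 2⌋₊, (x j : ℝ) := by
  /- the parameters `K = 2⌈1/ε⌉`, `M = ⌊10/ε²⌋`, and `t = 1/ε > 2` -/
  set M : ℕ := ⌊10 / ε ^ 2⌋₊ with hMdef
  set K : ℕ := 2 * ⌈1 / ε⌉₊ with hKdef
  set t : ℝ := 1 / ε with ht
  have ht2 : 2 < t := by rw [ht, lt_div_iff₀ hε]; linarith
  have hεt : ε = 1 / t := by rw [ht, one_div_one_div]
  have hKge : 2 * t ≤ (K : ℝ) := by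
    rw [hKdef]; push_cast
    have := Nat.le_ceil (1 / ε)
    linarith
  have hKlt : (K : ℝ) < 2 * t + 2 := by
    rw [hKdef]; push_cast
    have := Nat.ceil_lt_add_one (show (0 : ℝ) ≤ 1 / ε by positivity)
    linarith
  have hMgt : 10 * t ^ 2 - 1 < (M : ℝ) := by
    have h1 := Nat.lt_floor_add_one (10 / ε ^ 2)
    have h2 : (10 : ℝ) / ε ^ 2 = 10 * t ^ 2 := by rw [ht]; field_simp
    rw [hMdef]; linarith
  have hK0 : 0 < K := by
    have : (0 : ℝ) < K := by linarith
    exact_mod_cast this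
  have hKMt : (K : ℝ) * (2 * t) ≤ M := by
    have h1 : (K : ℝ) * (2 * t) < (2 * t + 2) * (2 * t) :=
      mul_lt_mul_of_pos_right hKlt (by positivity)
    have h2 : (2 * t + 2) * (2 * t) ≤ 10 * t ^ 2 - 1 := by nlinarith [sq_nonneg (t - 2)]
    linarith
  have hKM : K ≤ M := by
    have h1 : (K : ℝ) ≤ (K : ℝ) * (2 * t) := le_mul_of_one_le_right (by positivity) (by linarith)
    exact_mod_cast h1.trans hKMt
  have hM0 : 0 < M := lt_of_lt_of_le hK0 hKM
  have hM0' : (0 : ℝ) < M := by exact_mod_cast hM0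
  have hK0' : (0 : ℝ) < K := by exact_mod_cast hK0
  -- the three exponent comparisons
  have hexpK : (K : ℝ)⁻¹ ≤ ε / 2 := by
    calc (K : ℝ)⁻¹ ≤ (2 * t)⁻¹ := inv_anti₀ (by positivity) hKge
      _ = ε / 2 := by rw [hεt]; ring
  have hexpKM : (M : ℝ)⁻¹ * K ≤ ε / 2 := by
    rw [inv_mul_eq_div, div_le_iff₀ hM0', hεt]
    rw [show 1 / t / 2 * (M : ℝ) = M / (2 * t) by ring, le_div_iff₀ (by positivity)]
    exact hKMt
  have hexpM : (M : ℝ)⁻¹ ≤ ε / 2 := by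
    have h1 : (M : ℝ)⁻¹ ≤ (M : ℝ)⁻¹ * K :=
      le_mul_of_one_le_right (by positivity) (by exact_mod_cast hK0)
    exact h1.trans hexpKM
  /- the exact-multiplicity radicals and their products -/
  set N : ℕ := M + n with hNdef
  have hn0 : n ≠ 0 := hn.ne'
  have hnN : n ≤ N := Nat.le_add_left n M
  have hMN : M ≤ N := Nat.le_add_right M n
  set y : ℕ → ℕ := exactRadical n with hy
  have hy0 : ∀ j, 0 < y j := exactRadical_pos n
  set A : ℕ := ∏ j ∈ Ioc 0 M, y j ^ j with hA
  set B : ℕ := ∏ m ∈ Ioc M N, y m ^ m with hB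
  set P : ℕ := ∏ m ∈ Ioc M N, y m with hP
  set R : ℕ := ∏ j ∈ Ioc 0 M, y j with hR
  have hAB : A * B = n := by
    rw [hA, hB, prod_Ioc_consecutive _ (Nat.zero_le M) hMN]
    exact prod_exactRadical_pow hn0 hnN
  have hRP : R * P = radical n := by
    rw [hR, hP, prod_Ioc_consecutive _ (Nat.zero_le M) hMN]
    exact prod_exactRadical hn0 hnN
  have hA0 : 0 < A := prod_pos fun j _ => pow_pos (hy0 j) _
  have hP0 : 0 < P := prod_pos fun j _ => hy0 j
  have hBn : B ≤ n := by rw [← hAB]; exact Nat.le_mul_of_pos_left B hA0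
  have hPM : P ^ M ≤ B := by
    rw [hP, hB, ← prod_pow]
    exact prod_le_prod (fun i _ => Nat.zero_le _) fun m hm =>
      Nat.pow_le_pow_right (hy0 m) (mem_Ioc.mp hm).1.le
  have hPX : P ^ M ≤ X := hPM.trans (hBn.trans hnX)
  /- the factorisation -/
  set c : ℕ := ∏ m ∈ Ioc M N, y m ^ (m % K) with hc
  set Q : ℕ := ∏ m ∈ Ioc M N, y m ^ (m / K) with hQ
  set x : ℕ → ℕ := fun j => if j = K then y K * Q else y j with hx
  have hc0 : 0 < c := prod_pos fun j _ => pow_pos (hy0 j) _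
  have hQ0 : 0 < Q := prod_pos fun j _ => pow_pos (hy0 j) _
  have hxK : x K = y K * Q := by simp [hx]
  have hxj : ∀ j, j ≠ K → x j = y j := fun j hj => by simp [hx, hj]
  have hx0 : ∀ j, 0 < x j := fun j => by
    rcases eq_or_ne j K with rfl | hj
    · rw [hxK]; exact Nat.mul_pos (hy0 _) hQ0
    · rw [hxj j hj]; exact hy0 j
  have hKmem : K ∈ Ioc 0 M := mem_Ioc.mpr ⟨hK0, hKM⟩
  -- `c ∏ x_j^j = n`
  have hcQ : c * Q ^ K = B := by
    rw [hc, hQ, hB, ← prod_pow, ← prod_mul_distrib]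
    refine prod_congr rfl fun m _ => ?_
    rw [← pow_mul', ← pow_add, Nat.mod_add_div]
  have hprodx : ∏ j ∈ Ioc 0 M, x j ^ j = A * Q ^ K := by
    rw [hA, ← mul_prod_erase _ _ hKmem, ← mul_prod_erase (Ioc 0 M) (fun j => y j ^ j) hKmem,
      hxK, mul_pow]
    have h1 : ∏ j ∈ (Ioc 0 M).erase K, x j ^ j = ∏ j ∈ (Ioc 0 M).erase K, y j ^ j :=
      prod_congr rfl fun j hj => by rw [hxj j (ne_of_mem_erase hj)]
    rw [h1]; ring
  have hfactor : c * ∏ j ∈ Ioc 0 M, x j ^ j = n := by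
    rw [hprodx, ← hAB, ← hcQ]; ring
  -- `c ≤ X^{ε/2}`
  have hX1 : (1 : ℝ) ≤ X := by exact_mod_cast (hn.trans_le hnX : 0 < X)
  have hX0 : (0 : ℝ) ≤ X := by positivity
  have hXpos : (0 : ℝ) < X := by positivity
  have hcP : c ≤ P ^ K := by
    rw [hc, hP, ← prod_pow]
    exact prod_le_prod (fun i _ => Nat.zero_le _) fun m _ =>
      Nat.pow_le_pow_right (hy0 m) (Nat.mod_lt m hK0).le
  have hcle : (c : ℝ) ≤ (X : ℝ) ^ (ε / 2) := by
    calc (c : ℝ) ≤ (P : ℝ) ^ K := by exact_mod_cast hcP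
      _ ≤ ((X : ℝ) ^ ((M : ℝ)⁻¹)) ^ K := by
          gcongr
          exact cast_le_rpow_inv_of_pow_le hM0 hPX
      _ = (X : ℝ) ^ ((M : ℝ)⁻¹ * K) := (Real.rpow_mul_natCast hX0 _ K).symm
      _ ≤ (X : ℝ) ^ (ε / 2) := Real.rpow_le_rpow_of_exponent_le hX1 hexpKM
  -- `x_K ≤ X^{ε/2}` and `P ≤ X^{ε/2}`
  have hyKA : y K ^ K ≤ A := Nat.le_of_dvd hA0 (dvd_prod_of_mem (fun j => y j ^ j) hKmem)
  have hQB : Q ^ K ≤ B := by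
    rw [hQ, hB, ← prod_pow]
    exact prod_le_prod (fun i _ => Nat.zero_le _) fun m _ => by
      rw [← pow_mul']
      exact Nat.pow_le_pow_right (hy0 m) (Nat.mul_div_le m K)
  have hxKX : x K ^ K ≤ X := by
    rw [hxK, mul_pow]
    calc y K ^ K * Q ^ K ≤ A * B := Nat.mul_le_mul hyKA hQB
      _ = n := hAB
      _ ≤ X := hnX
  have hxKle : (x K : ℝ) ≤ (X : ℝ) ^ (ε / 2) :=
    (cast_le_rpow_inv_of_pow_le hK0 hxKX).trans (Real.rpow_le_rpow_of_exponent_le hX1 hexpK)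
  have hPle : (P : ℝ) ≤ (X : ℝ) ^ (ε / 2) :=
    (cast_le_rpow_inv_of_pow_le hM0 hPX).trans (Real.rpow_le_rpow_of_exponent_le hX1 hexpM)
  -- `rad n` versus `∏ x_j`
  have hRx : R ≤ ∏ j ∈ Ioc 0 M, x j := by
    rw [hR]
    refine prod_le_prod (fun i _ => Nat.zero_le _) fun j _ => ?_
    rcases eq_or_ne j K with rfl | hj
    · rw [hxK]; exact Nat.le_mul_of_pos_right _ hQ0
    · rw [hxj j hj]
  have hxR : ∏ j ∈ Ioc 0 M, x j ≤ x K * R := by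
    rw [hR, ← mul_prod_erase _ _ hKmem, ← mul_prod_erase (Ioc 0 M) y hKmem]
    have h1 : ∏ j ∈ (Ioc 0 M).erase K, x j = ∏ j ∈ (Ioc 0 M).erase K, y j :=
      prod_congr rfl fun j hj => by rw [hxj j (ne_of_mem_erase hj)]
    rw [h1, hxK]
    exact Nat.mul_le_mul_left _ (Nat.le_mul_of_pos_left _ (hy0 K))
  have hrad_le : ((radical n : ℕ) : ℝ) ≤ (X : ℝ) ^ ε * ∏ j ∈ Ioc 0 M, (x j : ℝ) := by
    have h1 : (R : ℝ) ≤ ∏ j ∈ Ioc 0 M, (x j : ℝ) := by exact_mod_cast hRx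
    have h2 : (P : ℝ) ≤ (X : ℝ) ^ ε :=
      hPle.trans (Real.rpow_le_rpow_of_exponent_le hX1 (by linarith))
    rw [← hRP, Nat.cast_mul]
    calc (R : ℝ) * P ≤ (∏ j ∈ Ioc 0 M, (x j : ℝ)) * (X : ℝ) ^ ε :=
          mul_le_mul h1 h2 (by positivity) (by positivity)
      _ = (X : ℝ) ^ ε * ∏ j ∈ Ioc 0 M, (x j : ℝ) := mul_comm _ _
  have hrad_ge : (X : ℝ) ^ (-ε) * ∏ j ∈ Ioc 0 M, (x j : ℝ) ≤ (radical n : ℕ) := by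
    have h1 : (∏ j ∈ Ioc 0 M, (x j : ℝ)) ≤ (x K : ℝ) * R := by exact_mod_cast hxR
    have hRrad : (R : ℝ) ≤ (radical n : ℕ) := by
      have h2 : R ≤ radical n := by rw [← hRP]; exact Nat.le_mul_of_pos_right _ hP0
      exact_mod_cast h2
    have hXε : (X : ℝ) ^ (-ε) * (X : ℝ) ^ (ε / 2) ≤ 1 := by
      rw [← Real.rpow_add hXpos]
      exact Real.rpow_le_one_of_one_le_of_nonpos hX1 (by linarith)
    calc (X : ℝ) ^ (-ε) * ∏ j ∈ Ioc 0 M, (x j : ℝ)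
        ≤ (X : ℝ) ^ (-ε) * ((x K : ℝ) * R) := by gcongr
      _ ≤ (X : ℝ) ^ (-ε) * ((X : ℝ) ^ (ε / 2) * (radical n : ℕ)) := by gcongr
      _ = ((X : ℝ) ^ (-ε) * (X : ℝ) ^ (ε / 2)) * (radical n : ℕ) := by ring
      _ ≤ 1 * (radical n : ℕ) := by gcongr
      _ = (radical n : ℕ) := one_mul _
  -- pairwise coprimality
  have hKcop : ∀ j ∈ Ioc 0 M, j ≠ K → Nat.Coprime (x K) (y j) := by
    intro j hj hjK
    rw [hxK]
    refine Nat.Coprime.mul_left (coprime_exactRadical n (Ne.symm hjK)) ?_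
    rw [hQ]
    refine Nat.Coprime.prod_left fun m hm => Nat.Coprime.pow_left _ ?_
    refine coprime_exactRadical n fun h => ?_
    have h1 := (mem_Ioc.mp hm).1
    have h2 := (mem_Ioc.mp hj).2
    omega
  have hcop : ∀ i ∈ Ioc 0 M, ∀ j ∈ Ioc 0 M, i ≠ j → Nat.Coprime (x i) (x j) := by
    intro i hi j hj hij
    rcases eq_or_ne i K with rfl | hiK
    · rw [hxj j hij.symm]; exact hKcop j hj hij.symm
    · rcases eq_or_ne j K with rfl | hjK
      · rw [hxj i hiK]; exact (hKcop i hi hiK).symm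
      · rw [hxj i hiK, hxj j hjK]; exact coprime_exactRadical n hij
  /- assemble, with `Icc 1 M = Ioc 0 M` -/
  have hI : Icc 1 M = Ioc 0 M := Finset.Icc_add_one_left_eq_Ioc 0 M
  refine ⟨c, x, hc0, hx0, ?_, hcle, ?_, ?_, ?_⟩
  · rw [hI]; exact hfactor
  · rw [hI]; exact hcop
  · rw [hI]; exact hrad_ge
  · rw [hI]; exact hrad_le

end Literature.NumberTheory.DiophantineGeometry
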